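import Mathlib.Algebra.BigOperators.Fin
import Mathlib.LinearAlgebra.Matrix.Trace
import Mathlib.RingTheory.MvPolynomial.Homogeneous
import Literature.Computability.AlgebraicComplexity.IMMInVP
import Literature.Computability.AlgebraicComplexity.ConstantFreeCircuits
import Literature.Computability.AlgebraicComplexity.ValiantClasses
import HarnessLib

/-!
# `IMM ∈ VP` — discharge of the named fact `isVPFamily_immPoly` (Kumar–Saraf 2017, §3)

Discharge (D-0014) of `Literature.Computability.AlgebraicComplexity.isVPFamily_immPoly`
(`IMMInVP.lean`): Kumar–Saraf, SIAM J. Comput. 46 (2017), §3 — "`IMM_{a,b}` … It is easy to see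
that this polynomial can be computed by a polynomial sized circuit, and so is in `VP`" — for the
tree's trace form `immPoly a b k = tr(X⁽⁰⁾ ⋯ X⁽ᵇ⁻¹⁾)` (`StandardFamilies.lean`) and the tree's
class predicate `IsVPFamily` (`ValiantClasses.lean`: p-bounded number of variables, degree and
fan-in-two `complexity`), over every field: for every `c`, `n ↦ immPoly (n^c) n k` is a `VP`
family (`isVPFamily_immPoly_holds`).

## The circuit, and how sharing is obtained without multi-output circuits

Multiply the matrices out one at a time: `tr(X⁽⁰⁾ X⁽¹⁾ X⁽²⁾ ⋯ X⁽ᵈ⁺¹⁾)` is obtained from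
`tr(Y⁽⁰⁾ Y⁽¹⁾ ⋯ Y⁽ᵈ⁾)` by SUBSTITUTING `Y⁽⁰⁾_{ij} ↦ ∑_l X⁽⁰⁾_{il} X⁽¹⁾_{lj}` and
`Y⁽ᵗ⁾ ↦ X⁽ᵗ⁺¹⁾` for `t ≥ 1` (`exists_immPoly_succ_succ`). By the substitution bound
`L(f(g₁, …, g_m)) ≤ L(f) + ∑ᵢ L(gᵢ)` (`complexity_aeval_le`, Bürgisser 2000, Rem. 2.7 — the
`complexity` twin of `constantFreeComplexity_aeval_le` of `ConstantFreeCircuits.lean`, same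
construction `substCircuit`/`juxtGates`) each step costs `∑ L(gᵢ) ≤ N² · 2N` gates, whence
`L(IMM_{N,d}) ≤ N + 2 N³ d` (`complexity_immPoly_le`), i.e. the `O(d N³)` circuit of the
source. With `N = n^c`, `d = n`: `n^{2c+1}` variables, degree `n` (homogeneity,
`immPoly_isHomogeneous_holds`), `L ≤ n^{3c+3} + (3c+3)`.

## References

* M. Kumar, S. Saraf, *On the power of homogeneous depth 4 arithmetic circuits*, SIAM J. Comput.
  46 (2017) 336–387, §3 ("Iterated Matrix Multiplication").
* P. Bürgisser, *Completeness and Reduction in Algebraic Complexity Theory*, Springer 2000,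
  Def. 2.1, proof of Prop. 2.3, Rem. 2.7 (substitution), Def. 2.3–2.4 (`VP`).
-/

noncomputable section

open MvPolynomial

namespace Literature.Computability.AlgebraicComplexity

universe u v w

/-! ### The substitution bound for `complexity` (Bürgisser 2000, Rem. 2.7) -/

section Subst

variable {k : Type u} {σ : Type v} {τ : Type w} [CommSemiring k]

open ArithCircuit

/-- **Substitution bound for `L`**: `L(f(g₁, …, g_m)) ≤ L(f) + ∑ᵢ L(gᵢ)` — juxtapose minimal
circuits for the `gᵢ` (`juxtGates`) and plug their outputs into the inputs of a minimal circuit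
for `f` (`substCircuit`); the `complexity` form of `constantFreeComplexity_aeval_le`
(Bürgisser 2000, proof of Prop. 2.3 and Rem. 2.7). [cite: Burgisser2000, Rem. 2.7] -/
theorem complexity_aeval_le [Fintype σ] (f : MvPolynomial σ k) (g : σ → MvPolynomial τ k) :
    complexity (aeval g f) ≤ complexity f + ∑ i, complexity (g i) := by
  classical
  obtain ⟨P, hP1, hP2, hP3⟩ := exists_computes_size_eq_complexity f
  choose Q hQ1 hQ2 hQ3 using fun i => exists_computes_size_eq_complexity (g i)
  set m := Fintype.card σ
  set e : σ ≃ Fin m := Fintype.equivFin σ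
  set L : List (ArithCircuit k τ) := List.ofFn fun j : Fin m => Q (e.symm j) with hL
  have hLlen : L.length = m := by simp [hL]
  have hmemL : ∀ R ∈ L, ∃ i, R = Q i := fun R hR => by
    simp only [hL, List.mem_ofFn] at hR
    obtain ⟨j, rfl⟩ := hR
    exact ⟨_, rfl⟩
  set ρ : σ → Operand k τ := fun i => (juxtOuts L)[(e i : ℕ)]'(by simp [hLlen]) with hρ
  have hρeval : ∀ i ws, (ρ i).eval (gateValues (juxtGates L) ++ ws) = g i := fun i ws => by
    have hi : ((e i : ℕ)) < L.length := by simp [hLlen]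
    have h := eval_juxtOuts L (e i) hi ws
    simp only [hρ]
    rw [h]
    have : L[(e i : ℕ)]'hi = Q i := by simp [hL, List.getElem_ofFn]
    rw [this]
    exact hQ2 i
  have hcomp : (P.substCircuit (juxtGates L) ρ).Computes (aeval g f) := by
    rw [Computes] at hP2 ⊢
    rw [eval_substCircuit P (juxtGates L) hρeval, hP2]
  have hfan : (P.substCircuit (juxtGates L) ρ).IsFanInTwo :=
    hP1.substCircuit (fanIn_juxtGates fun R hR => by
      obtain ⟨i, rfl⟩ := hmemL R hR; exact hQ1 i) ρ
  refine (complexity_le_size hfan hcomp).trans (le_of_eq ?_)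
  rw [size_substCircuit, length_juxtGates, hP3, add_comm]
  congr 1
  rw [hL, List.map_ofFn, List.sum_ofFn]
  simp only [Function.comp_def, hQ3]
  exact Fintype.sum_equiv e.symm _ _ fun j => rfl

end Subst

/-! ### The one-matrix-at-a-time recursion for `IMM` -/

section IMM

variable (k : Type u) [CommSemiring k] (N : ℕ)

/-- **One matrix at a time.** `IMM_{N,d+2} = tr(X⁽⁰⁾ ⋯ X⁽ᵈ⁺¹⁾)` is the image of
`IMM_{N,d+1} = tr(Y⁽⁰⁾ ⋯ Y⁽ᵈ⁾)` under the substitution `Y⁽⁰⁾_{ij} ↦ ∑_l X⁽⁰⁾_{il} X⁽¹⁾_{lj}`,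
`Y⁽ᵗ⁾_{ij} ↦ X⁽ᵗ⁺¹⁾_{ij}` (`t ≥ 1`), whose `N²` merged entries cost `≤ 2N` gates each and whose
shifted variables cost nothing: `∑_v L(g v) ≤ 2 N³`. [cite: KumarSaraf2017, §3] -/
theorem exists_immPoly_succ_succ (d : ℕ) :
    ∃ g : Fin (d + 1) × Fin N × Fin N → MvPolynomial (Fin (d + 2) × Fin N × Fin N) k,
      immPoly N (d + 2) k = aeval g (immPoly N (d + 1) k) ∧ ∑ v, complexity (g v) ≤ 2 * N ^ 3 := by
  classical
  -- the generic matrices `G e t = X⁽ᵗ⁾` among `e`, as in the definition of `immMatrix`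
  set G : (e : ℕ) → Fin e → Matrix (Fin N) (Fin N) (MvPolynomial (Fin e × Fin N × Fin N) k) :=
    fun e t => (Matrix.mvPolynomialX (Fin N) (Fin N) k).map
      (rename fun ij : Fin N × Fin N => (t, ij)) with hGdef
  have hG : ∀ (e : ℕ) (t : Fin e) (i j : Fin N), G e t i j = X (t, i, j) := fun e t i j => by
    simp [hGdef, Matrix.mvPolynomialX]
  have himm : ∀ e : ℕ, immMatrix (Fin N) e k = ((List.finRange e).map (G e)).prod := fun e => rfl
  -- the substitution
  set g : Fin (d + 1) × Fin N × Fin N → MvPolynomial (Fin (d + 2) × Fin N × Fin N) k :=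
    fun v => if v.1 = 0 then ∑ l : Fin N, X (0, v.2.1, l) * X (1, l, v.2.2)
      else X (v.1.succ, v.2.1, v.2.2) with hgdef
  have hg0 : ∀ i j : Fin N, g (0, i, j) = ∑ l : Fin N, X (0, i, l) * X (1, l, j) := fun i j => by
    simp [hgdef]
  have hgs : ∀ (t : Fin d) (i j : Fin N), g (t.succ, i, j) = X (t.succ.succ, i, j) :=
    fun t i j => by simp [hgdef, Fin.succ_ne_zero]
  refine ⟨g, ?_, ?_⟩
  · -- the matrix identity `X⁽⁰⁾ ⋯ X⁽ᵈ⁺¹⁾ = (Y⁽⁰⁾ ⋯ Y⁽ᵈ⁾)(g)`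
    set F : MvPolynomial (Fin (d + 1) × Fin N × Fin N) k →+*
        MvPolynomial (Fin (d + 2) × Fin N × Fin N) k := (aeval g).toRingHom with hFdef
    have hF : ∀ p, F p = aeval g p := fun p => rfl
    have h0 : F.mapMatrix (G (d + 1) 0) = G (d + 2) 0 * G (d + 2) 1 := by
      ext i j
      simp [RingHom.mapMatrix_apply, Matrix.mul_apply, hG, hF, hg0]
    have hs : ∀ t : Fin d, F.mapMatrix (G (d + 1) t.succ) = G (d + 2) t.succ.succ := by
      intro t
      ext i j
      simp [RingHom.mapMatrix_apply, hG, hF, hgs]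
    have hM : immMatrix (Fin N) (d + 2) k = F.mapMatrix (immMatrix (Fin N) (d + 1) k) := by
      rw [himm, himm, map_list_prod, List.map_map, List.finRange_succ, List.finRange_succ]
      simp only [List.map_cons, List.map_map, List.prod_cons, Function.comp_def, h0, hs,
        Matrix.mul_assoc, Fin.succ_zero_eq_one]
    unfold immPoly
    rw [hM, RingHom.mapMatrix_apply, ← hF]
    exact (AddMonoidHom.map_trace F.toAddMonoidHom _).symm
  · -- the cost of the substitution
    have h0 : ∀ i j : Fin N, complexity (g (0, i, j)) ≤ 2 * N := by
      intro i j
      rw [hg0]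
      refine (complexity_finset_sum_le _ _).trans ?_
      have hterm : ∀ l : Fin N,
          complexity (X (((0 : Fin (d + 2)), i, l) : Fin (d + 2) × Fin N × Fin N) *
            X (((1 : Fin (d + 2)), l, j) : Fin (d + 2) × Fin N × Fin N) : MvPolynomial _ k) ≤ 1 :=
        fun l => (complexity_mul_le_holds _ _).trans
          (by rw [complexity_X_holds, complexity_X_holds])
      calc ∑ l : Fin N, complexity (X (((0 : Fin (d + 2)), i, l) : Fin (d + 2) × Fin N × Fin N) *
              X (((1 : Fin (d + 2)), l, j) : Fin (d + 2) × Fin N × Fin N) : MvPolynomial _ k) +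
              (Finset.univ : Finset (Fin N)).card
          ≤ ∑ _l : Fin N, 1 + (Finset.univ : Finset (Fin N)).card := by
            gcongr with l _
            exact hterm l
        _ = 2 * N := by simp; ring
    have hs : ∀ (t : Fin d) (i j : Fin N), complexity (g (t.succ, i, j)) = 0 := by
      intro t i j
      rw [hgs]
      exact complexity_X_holds _
    calc ∑ v, complexity (g v)
        = ∑ t : Fin (d + 1), ∑ i : Fin N, ∑ j : Fin N, complexity (g (t, i, j)) := by
          rw [Fintype.sum_prod_type]
          exact Finset.sum_congr rfl fun t _ => Fintype.sum_prod_type _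
      _ = ∑ i : Fin N, ∑ j : Fin N, complexity (g (0, i, j)) := by
          rw [Fin.sum_univ_succ]
          simp [hs]
      _ ≤ ∑ _i : Fin N, ∑ _j : Fin N, 2 * N :=
          Finset.sum_le_sum fun i _ => Finset.sum_le_sum fun j _ => h0 i j
      _ = 2 * N ^ 3 := by simp; ring

/-- `IMM_{N,0} = tr(1) = N` is a constant: no gates. [cite: KumarSaraf2017, §3] -/
theorem complexity_immPoly_zero : complexity (immPoly N 0 k) = 0 := by
  have h : immPoly N 0 k = C (N : k) := by
    simp [immPoly, immMatrix, Matrix.trace_one, map_natCast]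
  rw [h]
  exact complexity_C_holds _

/-- `IMM_{N,1} = tr(X⁽⁰⁾) = ∑ᵢ X⁽⁰⁾_{ii}` costs at most `N` gates. [cite: KumarSaraf2017, §3] -/
theorem complexity_immPoly_one_le : complexity (immPoly N 1 k) ≤ N := by
  classical
  have h : immPoly N 1 k = ∑ i : Fin N, X (((0 : Fin 1), i, i) : Fin 1 × Fin N × Fin N) := by
    simp [immPoly, immMatrix, List.finRange_succ, Matrix.trace, Matrix.mvPolynomialX]
  rw [h]
  refine (complexity_finset_sum_le _ _).trans ?_
  have hX : ∀ i : Fin N,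
      complexity (X (((0 : Fin 1), i, i) : Fin 1 × Fin N × Fin N) : MvPolynomial _ k) = 0 :=
    fun i => complexity_X_holds _
  simp [hX]

/-- **`L(IMM_{N,d}) ≤ N + 2 N³ d`**: the iterated-product circuit of Kumar–Saraf §3, gate by
gate. [cite: KumarSaraf2017, §3] -/
theorem complexity_immPoly_le (d : ℕ) : complexity (immPoly N d k) ≤ N + 2 * N ^ 3 * d := by
  suffices h : ∀ d, complexity (immPoly N (d + 1) k) ≤ N + 2 * N ^ 3 * d by
    cases d with
    | zero => simp [complexity_immPoly_zero]
    | succ d => exact (h d).trans (Nat.add_le_add_left (Nat.mul_le_mul_left _ (Nat.le_succ d)) _)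
  intro d
  induction d with
  | zero => simpa using complexity_immPoly_one_le k N
  | succ d ih =>
    obtain ⟨g, hg, hcost⟩ := exists_immPoly_succ_succ k N d
    rw [hg]
    calc complexity (aeval g (immPoly N (d + 1) k))
        ≤ complexity (immPoly N (d + 1) k) + ∑ v, complexity (g v) := complexity_aeval_le _ _
      _ ≤ (N + 2 * N ^ 3 * d) + 2 * N ^ 3 := Nat.add_le_add ih hcost
      _ = N + 2 * N ^ 3 * (d + 1) := by ring

end IMM

/-! ### The discharge -/

/-- Polynomial bookkeeping: `n^c + 2 (n^c)³ n ≤ n^{3c+3} + (3c+3)`. [folklore] -/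
theorem imm_cost_le (c n : ℕ) : n ^ c + 2 * (n ^ c) ^ 3 * n ≤ n ^ (3 * c + 3) + (3 * c + 3) := by
  rcases Nat.lt_or_ge n 2 with hn | hn
  · obtain rfl | rfl : n = 0 ∨ n = 1 := by omega
    · cases c <;> simp
    · simp only [one_pow, Nat.mul_one]
      omega
  · have h1 : n ^ c ≤ n ^ (3 * c + 1) := Nat.pow_le_pow_right (by omega) (by omega)
    have h2 : 2 * (n ^ c) ^ 3 * n = 2 * n ^ (3 * c + 1) := by ring
    have h3 : 3 * n ^ (3 * c + 1) ≤ n ^ (3 * c + 3) := by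
      calc 3 * n ^ (3 * c + 1) ≤ (n * n) * n ^ (3 * c + 1) :=
            Nat.mul_le_mul_right _ (by nlinarith)
        _ = n ^ (3 * c + 3) := by ring
    omega

/-- **Discharge of `isVPFamily_immPoly`** (`IMM ∈ VP`, Kumar–Saraf 2017, §3): for every field `k`
and exponent `c`, `n ↦ immPoly (n^c) n k` has `n^{2c+1}` variables, degree `≤ n`, and
complexity `≤ n^{3c+3} + (3c+3)`. [cite: KumarSaraf2017, §3] -/
theorem isVPFamily_immPoly_holds : isVPFamily_immPoly := by
  intro k _ c
  refine ⟨⟨⟨2 * c + 1, fun n => ?_⟩, ⟨1, fun n => ?_⟩⟩, ⟨3 * c + 3, fun n => ?_⟩⟩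
  · simp only [Fintype.card_prod, Fintype.card_fin]
    calc n * (n ^ c * n ^ c) = n ^ (2 * c + 1) := by ring
      _ ≤ n ^ (2 * c + 1) + (2 * c + 1) := Nat.le_add_right _ _
  · exact ((immPoly_isHomogeneous_holds (k := k) (n ^ c) n).totalDegree_le).trans (by simp)
  · exact (complexity_immPoly_le k (n ^ c) n).trans (imm_cost_le c n)

end Literature.Computability.AlgebraicComplexity
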